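import Summits.QuantumFields.YangMills.Theorems.BalabanUVNodesN21ShellSplitOfRecord13CoPHDefs

/-!
# N21 (NE7c) · THE SELECTED TOP CUT — definition lane: the geometric grid of top cuts below the threshold of record, the BAND of a (2.18) term of record
# between two cut letters, the two runs' band masses ∕ term masses ∕ normalised band BADNESS per depth, the ARGMIN depth `selDepth₁₃`, and the keyed shell split
# `shellSplitSelected₁₃At N K₀ ρ n : ShellSplit₁₃CoPH N K₀` — a SECOND named inhabitant of dag-n20-d's residual reading of `crOfRecord₁₃At K₀ jcut sh` (p587226)

R134 seat `pub-ymgap-dag-n21-d` (g10), node N21 = NE7c (single-run shell-weight bound; NOT PRINTED in [Bałaban 1983–89], NOT proved at print's fixed thresholds),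
strategy s2 = the by-name knit AT THE RECORD; lane K3⁷ `SpineGivenEndpointR13SepCoPH` (stmt-QuantumFields-20544, `--supports … --as helper`; COUNT-NEUTRAL).
DEFINITION LANE: nine `def`s ∕ two `abbrev`-grade letters + `rfl` faces; NO estimate.  Companion (theorems): `…N21ShellSplitSelected13CoPH` — the (R)-fields, the
per-cube DISJOINTNESS of the bands along the grid, the COVER, g9's COUNT, the PIGEONHOLE at the argmin depth ⇒ `T4IndicatorShell.ShellWeightBound` at
`crOfRecord₁₃At K₀ jcut (shellSplitSelected₁₃At N K₀ ρ n)` with NO anti-concentration hypothesis.  Imports g9's definition lane `…N21ShellSplitOfRecord13CoPHDefs`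
(p591252 + v1.1 p595424 + v1.2 p598569: `cubeChiAt`, `cubesOfSeq`, `shellWeightOfDatum₉`, `WidthLetter₁₃CoPH`, `shellSplitOfRecord₁₃At`, …) and through it n20-d's
`…SpineReadingOfRecord13CoPH` and def-T's `Node00/StepWeightsAtThresholds` (`chiSeqOfRecordAt`, «thresholds as a letter»).
[III] = [Balaban1988Convergent], [LF-I] = [Balaban1989LargeFieldI].

THE IDEA (this seat's g4∕g5 selection road — `…N21ThresholdSelection` p484430, `…N21AtSRec13CoPHSelected` p547751: «(M1) holds at SOME threshold of every window, for
ANY finite family of finite laws» — carried to the READING OF RECORD as a named shell split).  Fix a tuple, a comparison index `K`, a source `t`, a relative width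
`ρ = ρ_K` and a depth `n = n_K`.  Along the geometric grid of top cuts `θ_i := ε_k(1 − ρ)^i` (`θ_0 = ε_k` of record, `θ_{i+1} = θ_i(1 − ρ)`) the BAND of a term `s`
at depth `i` is `∫ χ_k^{ε_k}(s)·χ_k^{θ_i}(s)(1 − χ_k^{θ_{i+1}}(s))·slot_s` — the part of its class weight on which every top cube of `Ω_k(s)` passes the (2.17) test at
`θ_i` and some top cube fails it at `θ_{i+1}` (g9's shell part of record `shellWeightOfDatum₉ ρ` IS the band at depth `0`, companion `bandWeightOfDatum₉_top`).  ONE cube's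
band indicators at different depths are DISJOINT ({0,1}-valued, monotone along the grid), so the bands of all depths `i ≤ n` of all terms weigh at most `#(top cubes)`
times the run's dressed partition sum — `(2L^m)⁴` by g9's count — and the depth `i⋆ = selDepth₁₃ … K t` MINIMISING the two runs' normalised band masses
`bandBadness₁₃ … i = Σ_s band^A_i ∕ Σ_s A + Σ_s band^B_i ∕ Σ_s B` carries, IN EACH RUN, a band of relative weight `≤ 2(2L^m)⁴∕(n + 1)`: summable over `K` as soon as
`Σ_K 1∕(n_K + 1) < ∞`, with NO estimate on Bałaban's densities.

WHAT IS DEFINED (objects; faces `rfl`).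
* §6 `cutGrid ν g k ρ i := ε_k·(1 − ρ)^i` · `bandWeightOfDatum₉ … θ θ′ t s := ∫ χ_k^{ε_k}(s)·(χ_k^{θ}(s)·(1 − χ_k^{θ′}(s)))·slot^t_s` (NODE 00's generality `ϑ D g₀ os p g k`).
* §7 at the `CoPH`-keyed Stage-13 record (n20-d's letters `runA₁₃ ∕ runB₁₃ ∕ histA₁₃ ∕ histB₁₃ ∕ keyA₁₃ ∕ keyB₁₃`): `bandSumA₁₃ ∕ bandSumB₁₃` (a run's total band mass at
  depth `i`), `massA₁₃ ∕ massB₁₃` (its dressed partition sum `Σ_s classWeightOfDatum₉`), `bandBadness₁₃` (the normalised two-run band mass of a depth), ★ `selDepth₁₃ … ρ n K t`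
  (an ARGMIN of the badness over `range (n + 1)`, `Finset.exists_min_image` + `Classical.choose`; spec `selDepth₁₃_spec`), the keyed bands at the selected depth
  `bandA₁₃ ∕ bandB₁₃` (fibre sums along `keyA₁₃ ∕ keyB₁₃`), the depth letters `DepthLetter₁₃CoPH`, and ★ `shellSplitSelected₁₃At N K₀ ρ n : ShellSplit₁₃CoPH N K₀` with its
  `rfl` dictionary against `crOfRecord₁₃At K₀ jcut (shellSplitSelected₁₃At N K₀ ρ n)` (`…_shA ∕ _shB`).  ONE width letter `ρ` serves both runs (a common RELATIVE depth
  `(1 − ρ_K)^{i⋆}` below each run's own `ε` keeps U5a's synchronised thresholds synchronised).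

HONEST FRAMING (binding, A6-grade).  Definitions; NO estimate.  AT THE READING OF RECORD the terms carry their sharp top cut at print's `ε_k` — in the front factor
`χ_k^{ε_k}` AND in the (3.2) step weight (def-T FILE 19: «ONE letter `ε` for (2.17)_{k+1} and (3.2) — as in print») — so the selected band `[θ_{i⋆+1}, θ_{i⋆})` is ADJACENT
to the terms' own cut only when `i⋆ = 0`: for a consumer matching the record's `ε`-cut terms (T4IndicatorShell design (i) AT `ε_k`) this split is worth NO MORE than the
zero split.  Its consumer is the THRESHOLD-LETTER reading (top front factor and (3.2) weight at the selected letter `Θ_k := θ_{i⋆}(K,t)`, def-T's `chiSeqOfRecordAt ∕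
wOfRecordAt ∕ texpAOfRecordAt`; [LF-I] p. 181 «the printed threshold LADDERS are deliberately non-sharp»), where the band IS design (i)'s single-run shell and the
companion's GENERIC pigeonhole (depth-indexed slot families under a pointwise envelope) applies verbatim — NOT typed here (needs the lettered dressed family, lettered
E1∕E2, a lettered reading, and the K3 skeleton's `PinnedAtLive` to admit it: LOCATED on the cell bus, dag-n21-d g10 STARTED line).  `ρ ∕ n` are LETTERS; no
`Provisos₁₃CoPH` inhabitant claimed (K0⁷ open); NE7c NOT PRINTED ∕ NOT proved at print's thresholds; N21 NOT discharged; K3⁷ NOT claimed; counts UNMOVED (typed 28∕28 ·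
discharged 5∕27); never a count claim.  No `sorry`, no `axiom`, no `instance`, no `notation`.  One finite four-torus programme at fixed `ε` — NOT ℝ⁴, NOT OS, NOT a
mass gap, NOT the Clay problem.
-/

noncomputable section

open scoped BigOperators
open Finset MeasureTheory

namespace Summit.QuantumFields.YangMills.Theorems.N21ShellSplitOfRecord13CoPH

open Literature.MathematicalPhysics.QuantumFieldTheory.Balaban1983to89
open Literature.MathematicalPhysics.QuantumFieldTheory.Balaban1983to89.T4Continuum
open Literature.MathematicalPhysics.QuantumFieldTheory.Balaban1983to89.Node00
open YMDAG.UVSplit (crOfRecord₁₃At ShellSplit₁₃CoPH keyA₁₃ keyB₁₃ runA₁₃ runB₁₃ histA₁₃ histB₁₃)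

/-! ## §6 The geometric grid of top cuts and the band of a term between two cut letters (NODE 00's generality) -/

section Band

variable (F : T4Family) (N : ℕ) [NeZero N] (ϑ : Stage9Params F N) (D : FiniteEpsData F (SU N)) (g₀ : ℕ → ℝ) (os : List (ULoop F))
  (p : B12.RunParams) (g : ℕ → ℝ) (k : ℕ)

variable {F} in
/-- **THE GEOMETRIC GRID OF TOP CUTS** below the (2.17) threshold of record at level `k`: `θ_i := ε_k · (1 − ρ)^i` (`θ_0 = ε_k`, `θ_{i+1} = θ_i(1 − ρ)`).
[bookkeeping] -/
def cutGrid (ν : Stage7Numerics) (g : ℕ → ℝ) (k : ℕ) (ρ : ℝ) (i : ℕ) : ℝ :=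
  epsOfRecord ν g k * (1 - ρ) ^ i

variable {F} in
/-- Face: the grid starts at the threshold of record. [bookkeeping] -/
@[simp] theorem cutGrid_zero (ν : Stage7Numerics) (g : ℕ → ℝ) (k : ℕ) (ρ : ℝ) : cutGrid ν g k ρ 0 = epsOfRecord ν g k := by
  simp [cutGrid]

variable {F} in
/-- Face: one step down the grid multiplies the cut by `1 − ρ`. [bookkeeping] -/
theorem cutGrid_succ (ν : Stage7Numerics) (g : ℕ → ℝ) (k : ℕ) (ρ : ℝ) (i : ℕ) : cutGrid ν g k ρ (i + 1) = cutGrid ν g k ρ i * (1 - ρ) := by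
  simp [cutGrid, pow_succ, mul_assoc]

/-- ★ **THE BAND OF A TERM BETWEEN TWO CUT LETTERS `θ′ ≤ θ`** (run at cutoff `p.K`, level `k`, source `t`, sequence `s`), INSIDE the term (the front factor of record kept):
`∫ χ_k^{ε_k}(Ω_k(s))(V)·(χ_k^{θ}(Ω_k(s))(V)·(1 − χ_k^{θ′}(Ω_k(s))(V)))·slot^t_k(s)(V) dV_k` — the part of the class weight `classWeightOfDatum₉ … k t s` carried by fields for
which every top cube of `s` passes the (2.17) test at the letter `θ` while SOME top cube fails it at `θ′`.  At `(θ, θ′) = (ε_k, ε_k(1 − ρ))` it is g9's shell part of record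
`shellWeightOfDatum₉ … ρ t s` (companion `bandWeightOfDatum₉_top`); along the grid, `(θ, θ′) = (θ_i, θ_{i+1})`. [bookkeeping] -/
def bandWeightOfDatum₉ (θ θ' t : ℝ) (s : SeqOfRecord F ϑ.ν ϑ.τ9.M g p.K k) : ℝ :=
  ∫ V, chiSeqOfRecord F N ϑ.ν ϑ.τ9.M g p.K k s V *
      (chiSeqOfRecordAt F N ϑ.ν ϑ.τ9.M g p.K k θ s V * (1 - chiSeqOfRecordAt F N ϑ.ν ϑ.τ9.M g p.K k θ' s V)) *
      dressedSlotsOfDatum₉ F N ϑ D g₀ os t p g k s V ∂fieldMeasure (F.P p.K) k (SU N)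

end Band

/-! ## §7 At the `CoPH`-keyed Stage-13 record: band masses, term masses, the badness of a depth, the ARGMIN depth, the keyed bands, the selected shell split -/

section KeyedSel

variable {F : T4Family} {N : ℕ} [NeZero N]

/-- **RUN A's TOTAL BAND MASS AT DEPTH `i`** (comparison `K`, level `K₀ + K`, width `ρ K`, source `t`): `Σ_s band_s(θ_i, θ_{i+1})` over the run's (2.18) histories.
[bookkeeping] -/
def bandSumA₁₃ (θ : Stage13HParams F N) (hP : θ.Provisos₁₃CoPH F N) (K₀ : ℕ) (g₀ : ℕ → ℝ) (os : List (ULoop F)) (ρ : ℕ → ℝ) (K i : ℕ) (t : ℝ) : ℝ :=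
  ∑ s : SeqOfRecord F θ.ν θ.τ9.M (histA₁₃ θ K₀ g₀ K) (K₀ + K) (K₀ + K),
    bandWeightOfDatum₉ F N θ.toStage9Params (datumOfRecord₁₃CoPH F N θ hP) g₀ os (runA₁₃ F K₀ g₀ K) (histA₁₃ θ K₀ g₀ K) (K₀ + K)
      (cutGrid θ.ν (histA₁₃ θ K₀ g₀ K) (K₀ + K) (ρ K) i) (cutGrid θ.ν (histA₁₃ θ K₀ g₀ K) (K₀ + K) (ρ K) (i + 1)) t s

/-- **RUN B's TOTAL BAND MASS AT DEPTH `i`** (comparison `K`, level `K₀ + K + 1`). [bookkeeping] -/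
def bandSumB₁₃ (θ : Stage13HParams F N) (hP : θ.Provisos₁₃CoPH F N) (K₀ : ℕ) (g₀ : ℕ → ℝ) (os : List (ULoop F)) (ρ : ℕ → ℝ) (K i : ℕ) (t : ℝ) : ℝ :=
  ∑ s' : SeqOfRecord F θ.ν θ.τ9.M (histB₁₃ θ K₀ g₀ K) (K₀ + K + 1) (K₀ + K + 1),
    bandWeightOfDatum₉ F N θ.toStage9Params (datumOfRecord₁₃CoPH F N θ hP) g₀ os (runB₁₃ F K₀ g₀ K) (histB₁₃ θ K₀ g₀ K) (K₀ + K + 1)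
      (cutGrid θ.ν (histB₁₃ θ K₀ g₀ K) (K₀ + K + 1) (ρ K) i) (cutGrid θ.ν (histB₁₃ θ K₀ g₀ K) (K₀ + K + 1) (ρ K) (i + 1)) t s'

/-- **RUN A's DRESSED PARTITION SUM** `Σ_s classWeightOfDatum₉ …` at comparison `K`, source `t` (= `Σ_{x ∈ classSet₁₃} weightA₁₃ … K t x`, companion). [bookkeeping] -/
def massA₁₃ (θ : Stage13HParams F N) (hP : θ.Provisos₁₃CoPH F N) (K₀ : ℕ) (g₀ : ℕ → ℝ) (os : List (ULoop F)) (K : ℕ) (t : ℝ) : ℝ :=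
  ∑ s : SeqOfRecord F θ.ν θ.τ9.M (histA₁₃ θ K₀ g₀ K) (K₀ + K) (K₀ + K),
    classWeightOfDatum₉ F N θ.toStage9Params (datumOfRecord₁₃CoPH F N θ hP) g₀ os (runA₁₃ F K₀ g₀ K) (histA₁₃ θ K₀ g₀ K) (K₀ + K) t s

/-- **RUN B's DRESSED PARTITION SUM** at comparison `K`, source `t`. [bookkeeping] -/
def massB₁₃ (θ : Stage13HParams F N) (hP : θ.Provisos₁₃CoPH F N) (K₀ : ℕ) (g₀ : ℕ → ℝ) (os : List (ULoop F)) (K : ℕ) (t : ℝ) : ℝ :=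
  ∑ s' : SeqOfRecord F θ.ν θ.τ9.M (histB₁₃ θ K₀ g₀ K) (K₀ + K + 1) (K₀ + K + 1),
    classWeightOfDatum₉ F N θ.toStage9Params (datumOfRecord₁₃CoPH F N θ hP) g₀ os (runB₁₃ F K₀ g₀ K) (histB₁₃ θ K₀ g₀ K) (K₀ + K + 1) t s'

/-- **THE BADNESS OF A DEPTH**: the two runs' band masses at depth `i`, each normalised by its run's dressed partition sum (`x ∕ 0 = 0`: a weightless run contributes
nothing). [bookkeeping] -/
def bandBadness₁₃ (θ : Stage13HParams F N) (hP : θ.Provisos₁₃CoPH F N) (K₀ : ℕ) (g₀ : ℕ → ℝ) (os : List (ULoop F)) (ρ : ℕ → ℝ) (K : ℕ) (t : ℝ) (i : ℕ) : ℝ :=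
  bandSumA₁₃ θ hP K₀ g₀ os ρ K i t / massA₁₃ θ hP K₀ g₀ os K t + bandSumB₁₃ θ hP K₀ g₀ os ρ K i t / massB₁₃ θ hP K₀ g₀ os K t

/-- ★ **THE SELECTED DEPTH** `i⋆(K, t) ≤ n`: an ARGMIN of the badness over the depths `0, …, n` (`Finset.exists_min_image` on `range (n + 1)`, a choice). [bookkeeping] -/
def selDepth₁₃ (θ : Stage13HParams F N) (hP : θ.Provisos₁₃CoPH F N) (K₀ : ℕ) (g₀ : ℕ → ℝ) (os : List (ULoop F)) (ρ : ℕ → ℝ) (n K : ℕ) (t : ℝ) : ℕ :=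
  Classical.choose ((Finset.range (n + 1)).exists_min_image (bandBadness₁₃ θ hP K₀ g₀ os ρ K t) ⟨0, Finset.mem_range.2 (Nat.succ_pos n)⟩)

/-- Spec of the selected depth: it is one of `0, …, n` and its badness is minimal there. [bookkeeping] -/
theorem selDepth₁₃_spec (θ : Stage13HParams F N) (hP : θ.Provisos₁₃CoPH F N) (K₀ : ℕ) (g₀ : ℕ → ℝ) (os : List (ULoop F)) (ρ : ℕ → ℝ) (n K : ℕ) (t : ℝ) :
    selDepth₁₃ θ hP K₀ g₀ os ρ n K t ∈ Finset.range (n + 1) ∧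
      ∀ j ∈ Finset.range (n + 1), bandBadness₁₃ θ hP K₀ g₀ os ρ K t (selDepth₁₃ θ hP K₀ g₀ os ρ n K t) ≤ bandBadness₁₃ θ hP K₀ g₀ os ρ K t j :=
  Classical.choose_spec ((Finset.range (n + 1)).exists_min_image (bandBadness₁₃ θ hP K₀ g₀ os ρ K t) ⟨0, Finset.mem_range.2 (Nat.succ_pos n)⟩)

/-- The selected depth is at most `n`. [bookkeeping] -/
theorem selDepth₁₃_le (θ : Stage13HParams F N) (hP : θ.Provisos₁₃CoPH F N) (K₀ : ℕ) (g₀ : ℕ → ℝ) (os : List (ULoop F)) (ρ : ℕ → ℝ) (n K : ℕ) (t : ℝ) :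
    selDepth₁₃ θ hP K₀ g₀ os ρ n K t ≤ n :=
  Nat.lt_succ_iff.1 (Finset.mem_range.1 (selDepth₁₃_spec θ hP K₀ g₀ os ρ n K t).1)

/-- **RUN A's KEYED BAND AT THE SELECTED DEPTH** (comparison `K`, source `t`, depth letters `n`): the fibre sum along n20-d's key of record `keyA₁₃` of the term bands
between `θ_{i⋆}` and `θ_{i⋆+1}`, `i⋆ = selDepth₁₃ … ρ (n K) K t`. [bookkeeping] -/
def bandA₁₃ (θ : Stage13HParams F N) (hP : θ.Provisos₁₃CoPH F N) (K₀ : ℕ) (g₀ : ℕ → ℝ) (os : List (ULoop F)) (ρ : ℕ → ℝ) (n : ℕ → ℕ)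
    (K : ℕ) (t : ℝ) (x : Σ K, SiteSeqKey F (K₀ + K)) : ℝ :=
  letI : ∀ Kc, DecidableEq (SiteSeqKey F Kc) := fun _ => Classical.decEq _
  ∑ s ∈ univ.filter (fun s => keyA₁₃ θ K₀ g₀ K s = x),
    bandWeightOfDatum₉ F N θ.toStage9Params (datumOfRecord₁₃CoPH F N θ hP) g₀ os (runA₁₃ F K₀ g₀ K) (histA₁₃ θ K₀ g₀ K) (K₀ + K)
      (cutGrid θ.ν (histA₁₃ θ K₀ g₀ K) (K₀ + K) (ρ K) (selDepth₁₃ θ hP K₀ g₀ os ρ (n K) K t))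
      (cutGrid θ.ν (histA₁₃ θ K₀ g₀ K) (K₀ + K) (ρ K) (selDepth₁₃ θ hP K₀ g₀ os ρ (n K) K t + 1)) t s

/-- **RUN B's KEYED BAND AT THE SELECTED DEPTH** (level `K₀ + K + 1`, along `keyB₁₃`; the SAME depth `i⋆(K, t)` as run A). [bookkeeping] -/
def bandB₁₃ (θ : Stage13HParams F N) (hP : θ.Provisos₁₃CoPH F N) (K₀ : ℕ) (g₀ : ℕ → ℝ) (os : List (ULoop F)) (ρ : ℕ → ℝ) (n : ℕ → ℕ)
    (K : ℕ) (t : ℝ) (x : Σ K, SiteSeqKey F (K₀ + K)) : ℝ :=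
  letI : ∀ Kc, DecidableEq (SiteSeqKey F Kc) := fun _ => Classical.decEq _
  ∑ s' ∈ univ.filter (fun s' => keyB₁₃ θ K₀ g₀ K s' = x),
    bandWeightOfDatum₉ F N θ.toStage9Params (datumOfRecord₁₃CoPH F N θ hP) g₀ os (runB₁₃ F K₀ g₀ K) (histB₁₃ θ K₀ g₀ K) (K₀ + K + 1)
      (cutGrid θ.ν (histB₁₃ θ K₀ g₀ K) (K₀ + K + 1) (ρ K) (selDepth₁₃ θ hP K₀ g₀ os ρ (n K) K t))
      (cutGrid θ.ν (histB₁₃ θ K₀ g₀ K) (K₀ + K + 1) (ρ K) (selDepth₁₃ θ hP K₀ g₀ os ρ (n K) K t + 1)) t s'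

variable (N) in
/-- **DEPTH LETTERS**: a grid depth per tuple and comparison index (the consumer's choice; `Σ_K 1∕(n_K + 1) < ∞` makes the selected band's weight summable). [bookkeeping] -/
abbrev DepthLetter₁₃CoPH : Type 1 :=
  (F : T4Family) → (θ : Stage13HParams F N) → θ.Provisos₁₃CoPH F N → (ℕ → ℝ) → List (ULoop F) → ℕ → ℕ

variable (N) in
/-- ★ **THE SELECTED SHELL SPLIT AT OFFSET `K₀`** with ONE width letter `ρ` (common to both runs) and a depth letter `n`: the pair `(bandA₁₃, bandB₁₃)` at every tuple —
an inhabitant of n20-d's `ShellSplit₁₃CoPH N K₀` whose `ShellWeightBound` the companion proves WITHOUT anti-concentration. [bookkeeping] -/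
def shellSplitSelected₁₃At (K₀ : ℕ) (ρ : WidthLetter₁₃CoPH N) (n : DepthLetter₁₃CoPH N) : ShellSplit₁₃CoPH N K₀ := fun F θ hP g₀ os =>
  (bandA₁₃ θ hP K₀ g₀ os (ρ F θ hP g₀ os) (n F θ hP g₀ os), bandB₁₃ θ hP K₀ g₀ os (ρ F θ hP g₀ os) (n F θ hP g₀ os))

/-- Dictionary: the split's first component is `bandA₁₃`. [bookkeeping] -/
@[simp] theorem shellSplitSelected₁₃At_fst (K₀ : ℕ) (ρ : WidthLetter₁₃CoPH N) (n : DepthLetter₁₃CoPH N) (F : T4Family) (θ : Stage13HParams F N)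
    (hP : θ.Provisos₁₃CoPH F N) (g₀ : ℕ → ℝ) (os : List (ULoop F)) :
    (shellSplitSelected₁₃At N K₀ ρ n F θ hP g₀ os).1 = bandA₁₃ θ hP K₀ g₀ os (ρ F θ hP g₀ os) (n F θ hP g₀ os) := rfl

/-- Dictionary: the split's second component is `bandB₁₃`. [bookkeeping] -/
@[simp] theorem shellSplitSelected₁₃At_snd (K₀ : ℕ) (ρ : WidthLetter₁₃CoPH N) (n : DepthLetter₁₃CoPH N) (F : T4Family) (θ : Stage13HParams F N)
    (hP : θ.Provisos₁₃CoPH F N) (g₀ : ℕ → ℝ) (os : List (ULoop F)) :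
    (shellSplitSelected₁₃At N K₀ ρ n F θ hP g₀ os).2 = bandB₁₃ θ hP K₀ g₀ os (ρ F θ hP g₀ os) (n F θ hP g₀ os) := rfl

/-- ★ Dictionary: the `shA` of the spine reading of record at the selected split is run A's keyed band at the selected depth (`rfl`). [bookkeeping] -/
theorem crOfRecord₁₃At_shellSplitSelected_shA (K₀ : ℕ) (jcut : ℕ → ℕ) (ρ : WidthLetter₁₃CoPH N) (n : DepthLetter₁₃CoPH N) (F : T4Family)
    (θ : Stage13HParams F N) (hP : θ.Provisos₁₃CoPH F N) (g₀ : ℕ → ℝ) (os : List (ULoop F)) :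
    (crOfRecord₁₃At K₀ jcut (shellSplitSelected₁₃At N K₀ ρ n) F θ hP g₀ os).shA = bandA₁₃ θ hP K₀ g₀ os (ρ F θ hP g₀ os) (n F θ hP g₀ os) := rfl

/-- ★ Dictionary: the `shB` of the spine reading of record at the selected split is run B's keyed band at the selected depth (`rfl`). [bookkeeping] -/
theorem crOfRecord₁₃At_shellSplitSelected_shB (K₀ : ℕ) (jcut : ℕ → ℕ) (ρ : WidthLetter₁₃CoPH N) (n : DepthLetter₁₃CoPH N) (F : T4Family)
    (θ : Stage13HParams F N) (hP : θ.Provisos₁₃CoPH F N) (g₀ : ℕ → ℝ) (os : List (ULoop F)) :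
    (crOfRecord₁₃At K₀ jcut (shellSplitSelected₁₃At N K₀ ρ n) F θ hP g₀ os).shB = bandB₁₃ θ hP K₀ g₀ os (ρ F θ hP g₀ os) (n F θ hP g₀ os) := rfl

end KeyedSel

end Summit.QuantumFields.YangMills.Theorems.N21ShellSplitOfRecord13CoPH

end
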